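import Literature.RepresentationTheory.KonnoKonno2007.RealUnitaryKAKStep
import HarnessLib

/-!
# The `KAK` decomposition of `U(α,β)` at arbitrary real rank, II: `U(α,β) = K · A · K`, properness, quotient maps,
# `K`-trivial characters — group side, kernel

Topic `RepresentationTheory/KonnoKonno2007`; namespace `Literature.RepresentationTheory.KonnoKonno2007.RealDualPair`.
KERNEL ONLY: three definitions with bodies (`hypA`, the product of commuting planar boosts; `kakMapA`, the word map;
`frob`, the Frobenius gauge), 0 records, 0 `Prop`-valued definitions, 0 hypotheses (tag `folklore` for private
plumbing only); everything is a kernel fact about the explicit matrix group `UForm α β = U(diag(1_α, −1_β))` of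
`RealUnitaryDualPair`, its maximal compact `UForm.kV : U(α) × U(β) →* U(α,β)` and the planar boosts `hypV p₀ q₀ t` of
`RealUnitaryRankOneKAK`, on top of `RealUnitaryFixers` (stabilisers) and `RealUnitaryKAKStep` (the one-plane step).

THE CARTAN DECOMPOSITION `G = K A K` [Knapp2002, Thm. 7.39] FOR `G = U(α,β)` OF ARBITRARY REAL RANK.  Frame: a family
of pairwise disjoint hyperbolic planes `(p j, q j)`, `j ∈ ι`, given by injections `p : ι → α`, `q : ι → β` one of which is
onto (so `|ι| = min(|α|, |β|)`, the real rank); `A = {a_t = ∏_j a^{(p j, q j)}_{t_j} : t ∈ ℝ^ι}` is the split torus of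
commuting planar boosts (`hypA`; the factors commute by `hypV_comm`).  The rank-one file `RealUnitaryRankOneKAK`
(`|β| = 1`, one plane) is the case `ι = β = {q₀}`.

* §1 `hypA hp hq T t = ∏_{j ∈ T} hypV (p j) (q j) (t j)` (`Finset.noncommProd`): `hypA_empty`, `hypA_insert`,
  `hypA_congr`, commutation with the fixer of the planes of `T` (`mul_hypA_comm_of_mem_fixer`), membership in fixers
  of other vectors (`hypA_mem_fixer`), continuity in `t` (`continuous_hypA`), the diagonal entries
  `(a_t)_{q j, q j} = cosh t_j` (`hypA_apply_inr_inr_self`);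
* §2 the induction over `T ⊆ ι` (`exists_kak_fixer`): every `g` is `k₁⁻¹ · a_t^{(T)} · h · k₂⁻¹` with `t ≥ 0` and `h`
  fixing the vectors of the planes of `T` — by `kak_step`, the new compact factors commuting with the boosts already
  produced; at `T = ι` the residual fixes one whole side, hence lies in `K` (`exists_eq_kV_inl_of_forall_inr` /
  `exists_eq_kV_inr_of_forall_inl`): **`exists_kV_mul_hypA_mul_kV_eq`** — `g = k₁ · a_t · k₂`, `k₁, k₂ ∈ K`, `t ≥ 0`;
* §3 the word map `kakMapA : K × ℝ^ι × K → U(α,β)`, continuous and onto (`kakMapA_surjective`,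
  `kakMapA_image_nonneg`);
* §4 PROPERNESS (`isProperMap_kakMapA`): the Frobenius gauge `frob g = Σ_{i,i'} |g_{i i'}|² = tr(gᴴg)` is continuous and
  bi-`K`-invariant (`frob_kV_mul`, `frob_mul_kV`), and `frob a_t ≥ Σ_j cosh² t_j ≥ Σ_j t_j²` (`sum_sq_le_frob_hypA`), so
  `frob ∘ kakMapA` is a proper function of `t` alone; closedness and compact preimages (`isClosedMap_kakMapA`,
  `isCompact_preimage_kakMapA`);
* §5 QUOTIENT MAPS: `isQuotientMap_kakMapA`, `isQuotientMap_kakMapA_prodMap X` (for `kakMapA × id_X`), and the descent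
  of continuity `continuous_iff_comp_kakMapA`, `continuous_iff_comp_kakMapA_prodMap` — continuity (resp. joint
  continuity with a parameter) on `U(α,β)` is continuity in `(k₁, t, k₂)`, at every real rank (the rank-one forms are
  `continuous_iff_comp_kakMap(_prodMap)` of `RealUnitaryRankOneKAK`, consumed by `JunctionContinuityKAK`);
* §6 CHARACTERS: a homomorphism from `U(α,β)` to a commutative group that is trivial on `K = U(α) × U(β)` is trivial,
  and two that agree on `K` agree (`UForm.hom_eq_one_of_forall_kV`, `UForm.hom_eq_of_forall_kV`) — at every rank, no
  continuity (Weyl element `w a_t w⁻¹ = a_{−t}` and `a_t = a_{t/2}²` plane by plane); the frame is chosen internally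
  (`Function.Embedding.nonempty_of_card_le`), so the statements mention no `ι`.  The rank-one forms are
  `Paul1998.MetaplecticSplitting.UForm.hom_eq_one_of_kV` (`[Subsingleton β]`) of `DetCoverCocycleRankOne`.

Provenance (statement shapes only; nothing is cited as a hypothesis): [Knapp2002, Thm. 7.39] (`G = K A⁺ K` for
semisimple/reductive `G`; here `G = U(p,q)`, `K = U(p) × U(q)`, `A` the planar boosts), [Helgason1978, Ch. IX, Thm. 1.1];
properness of `K × A × K → G` is the form in which the decomposition descends continuity statements.

BOUNDARY.  Imports only `RealUnitaryKAKStep` (tree) and Mathlib through it; no record, no `Prop` definition, no cited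
fact; nothing specific to the Hodge/Picard programme.

References: [Knapp2002] A. W. Knapp, *Lie Groups Beyond an Introduction*, 2nd ed., Birkhäuser 2002, Thm. 7.39;
[Helgason1978] S. Helgason, *Differential Geometry, Lie Groups, and Symmetric Spaces*, Academic Press 1978, Ch. IX §1;
[HornJohnson2013] R. A. Horn, C. R. Johnson, *Matrix Analysis*, 2nd ed., CUP 2013, 0.2.5 (trace), Thm. 2.1.4;
[KonnoKonno2007] K. Konno, T. Konno, Kyushu J. Math. 61 (2007), §3.1.
-/

set_option autoImplicit false

noncomputable section

open Matrix Complex Topology Filter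
open scoped ComplexConjugate

namespace Literature.RepresentationTheory.KonnoKonno2007

namespace RealDualPair

open Literature.NumberTheory.Automorphic Literature.NumberTheory.Automorphic.UnitaryGroup

/-! ## 1. The split torus `a_t = ∏_j a^{(p j, q j)}_{t_j}` -/

section HypA

variable {ι α β : Type*} [Fintype α] [DecidableEq α] [Fintype β] [DecidableEq β] {p : ι → α} {q : ι → β}

/-- **the product of the commuting planar boosts** `a_t^{(T)} = ∏_{j ∈ T} hypV (p j) (q j) (t j)` of the pairwise
disjoint planes `(p j, q j)`, `j ∈ T` (`p`, `q` injective). [cite: Knapp2002, Thm 7.39] -/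
def hypA (hp : Function.Injective p) (hq : Function.Injective q) (T : Finset ι) (t : ι → ℝ) : UForm α β :=
  T.noncommProd (fun j => hypV (p j) (q j) (t j)) fun j _ j' _ hne =>
    hypV_comm (p j') (q j') (hp.ne hne) (hq.ne hne) (t j) (t j')

variable (hp : Function.Injective p) (hq : Function.Injective q)

/-- no plane: `a = 1`. [cite: Knapp2002, Thm 7.39] -/
theorem hypA_empty (t : ι → ℝ) : (hypA hp hq ∅ t : UForm α β) = 1 :=
  Finset.noncommProd_empty _ _

/-- one more plane: `a^{(T ∪ {j})}_t = a^{(p j, q j)}_{t_j} · a^{(T)}_t`. [cite: Knapp2002, Thm 7.39] -/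
theorem hypA_insert [DecidableEq ι] {T : Finset ι} {j : ι} (hj : j ∉ T) (t : ι → ℝ) :
    (hypA hp hq (insert j T) t : UForm α β) = hypV (p j) (q j) (t j) * hypA hp hq T t :=
  Finset.noncommProd_insert_of_notMem _ _ _ _ hj

/-- `a^{(T)}_t` depends only on `t|_T`. [cite: Knapp2002, Thm 7.39] -/
theorem hypA_congr (T : Finset ι) {t t' : ι → ℝ} (h : ∀ j ∈ T, t j = t' j) :
    (hypA hp hq T t : UForm α β) = hypA hp hq T t' :=
  Finset.noncommProd_congr rfl (fun j hj => by rw [h j hj]) _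

/-- **an element fixing the vectors of the planes of `T` commutes with `a^{(T)}_t`.** [cite: Knapp2002, Thm 7.39] -/
theorem mul_hypA_comm_of_mem_fixer (T : Finset ι) (t : ι → ℝ) (g : UForm α β)
    (hg : g ∈ fixer α β (planeVecs p q T)) : g * hypA hp hq T t = hypA hp hq T t * g :=
  (Finset.noncommProd_commute _ _ _ g fun j hj =>
    mul_hypV_comm_of_mem_fixer (p j) (q j) g
      (fixer_mono (fun i hi => by
        rcases hi with h | h
        · exact ⟨j, hj, Or.inl h⟩
        · exact ⟨j, hj, Or.inr h⟩) hg) (t j)).eq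

/-- `a^{(T)}_t` fixes every basis vector off the planes of `T`. [cite: Knapp2002, Thm 7.39] -/
theorem hypA_mem_fixer (T : Finset ι) (t : ι → ℝ) {s : Set (α ⊕ β)} (hs₁ : ∀ j ∈ T, Sum.inl (p j) ∉ s)
    (hs₂ : ∀ j ∈ T, Sum.inr (q j) ∉ s) : (hypA hp hq T t : UForm α β) ∈ fixer α β s := by
  classical
  induction T using Finset.induction_on with
  | empty => rw [hypA_empty]; exact Subgroup.one_mem _
  | insert j T hj ih =>
    rw [hypA_insert hp hq hj]
    exact Subgroup.mul_mem _ (hypV_mem_fixer (p j) (q j) (hs₁ j (Finset.mem_insert_self _ _))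
      (hs₂ j (Finset.mem_insert_self _ _)) (t j))
      (ih (fun j' hj' => hs₁ j' (Finset.mem_insert_of_mem hj')) fun j' hj' => hs₂ j' (Finset.mem_insert_of_mem hj'))

/-- `t ↦ a^{(T)}_t` is continuous. [cite: Knapp2002, Thm 7.39] -/
theorem continuous_hypA (T : Finset ι) : Continuous fun t : ι → ℝ => (hypA hp hq T t : UForm α β) := by
  classical
  induction T using Finset.induction_on with
  | empty => simp_rw [hypA_empty]; exact continuous_const
  | insert j T hj ih =>
    simp_rw [hypA_insert hp hq hj]
    exact ((continuous_hypV (p j) (q j)).comp (continuous_apply j)).mul ih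

/-- **the diagonal entry `(a^{(T)}_t)_{q j, q j} = cosh t_j`** for `j ∈ T`. [cite: Knapp2002, Thm 7.39] -/
theorem hypA_apply_inr_inr_self (T : Finset ι) (t : ι → ℝ) {j : ι} (hj : j ∈ T) :
    (((hypA hp hq T t : UForm α β) : GL (α ⊕ β) ℂ) : Matrix (α ⊕ β) (α ⊕ β) ℂ) (Sum.inr (q j)) (Sum.inr (q j)) =
      (Real.cosh (t j) : ℂ) := by
  classical
  induction T using Finset.induction_on with
  | empty => exact absurd hj (Finset.notMem_empty _)
  | insert j' T hj' ih =>
    rw [hypA_insert hp hq hj', UForm.coe_mul, Matrix.mul_apply]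
    rcases Finset.mem_insert.1 hj with rfl | hjT
    · -- the new plane: column `q j` of `a^{(T)}` is a unit column
      have hc : ∀ i, (((hypA hp hq T t : UForm α β) : GL (α ⊕ β) ℂ) : Matrix (α ⊕ β) (α ⊕ β) ℂ) i (Sum.inr (q j)) =
          (1 : Matrix (α ⊕ β) (α ⊕ β) ℂ) i (Sum.inr (q j)) :=
        hypA_mem_fixer hp hq T t (s := {Sum.inr (q j)}) (fun _ _ h => Sum.inl_ne_inr h)
          (fun j'' hj'' h => hj' ((hq (Sum.inr_injective h)) ▸ hj'')) _ (Set.mem_singleton _)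
      rw [Finset.sum_congr rfl fun k _ => by rw [hc k], sum_mul_one_apply, hypV_inr_inr, if_pos rfl, if_pos rfl]
    · -- an old plane: row `q j` of the new boost is a unit row
      have hne : j' ≠ j := fun h => hj' (h ▸ hjT)
      have hr : ∀ k, (((hypV (p j') (q j') (t j') : UForm α β) : GL (α ⊕ β) ℂ) : Matrix (α ⊕ β) (α ⊕ β) ℂ)
          (Sum.inr (q j)) k = (1 : Matrix (α ⊕ β) (α ⊕ β) ℂ) (Sum.inr (q j)) k :=
        UForm.row_eq_of_col_eq _ _ (hypV_col_eq_one (p j') (q j') (t j') _ Sum.inr_ne_inl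
          fun h => hne (hq (Sum.inr_injective h)).symm)
      rw [Finset.sum_congr rfl fun k _ => by rw [hr k], sum_one_apply_mul, ih hjT]

end HypA

/-! ## 2. `U(α,β) = K · A · K` -/

section KAK

variable {ι α β : Type*} [Fintype α] [DecidableEq α] [Fintype β] [DecidableEq β] {p : ι → α} {q : ι → β}
  (hp : Function.Injective p) (hq : Function.Injective q)

/-- **the induction over the planes**: for every `T` and every `g ∈ U(α,β)` there are `k₁, k₂ ∈ K`, `t ≥ 0` and `h`
fixing the vectors of the planes of `T` with `k₁ · g · k₂ = a^{(T)}_t · h`. [cite: Knapp2002, Thm 7.39] -/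
theorem exists_kak_fixer (T : Finset ι) (g : UForm α β) :
    ∃ (k₁ k₂ : KV α β) (t : ι → ℝ) (h : UForm α β), (∀ j, 0 ≤ t j) ∧ h ∈ fixer α β (planeVecs p q T) ∧
      UForm.kV α β k₁ * g * UForm.kV α β k₂ = hypA hp hq T t * h := by
  classical
  induction T using Finset.induction_on with
  | empty =>
    refine ⟨1, 1, fun _ => 0, g, fun _ => le_rfl, fun i₀ hi₀ => ?_, ?_⟩
    · rw [planeVecs_empty] at hi₀
      exact absurd hi₀ (Set.notMem_empty _)
    · rw [map_one, one_mul, mul_one, hypA_empty, one_mul]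
  | insert j₁ T hj₁ ih =>
    obtain ⟨k₁, k₂, t, h, ht, hh, hg⟩ := ih
    obtain ⟨k, k', s, h', hs, hk, hk', hh', hstep⟩ := kak_step hp hq T j₁ hj₁ h hh
    refine ⟨k * k₁, k₂ * k', Function.update t j₁ s, h', fun j => ?_, hh', ?_⟩
    · by_cases hj : j = j₁
      · rw [hj, Function.update_self]; exact hs
      · rw [Function.update_of_ne hj]; exact ht j
    · calc UForm.kV α β (k * k₁) * g * UForm.kV α β (k₂ * k')
          = UForm.kV α β k * (UForm.kV α β k₁ * g * UForm.kV α β k₂) * UForm.kV α β k' := by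
            rw [map_mul, map_mul]; simp only [mul_assoc]
        _ = hypA hp hq T t * (UForm.kV α β k * h * UForm.kV α β k') := by
            rw [hg, ← mul_assoc, mul_hypA_comm_of_mem_fixer hp hq T t _ hk]; simp only [mul_assoc]
        _ = hypA hp hq (insert j₁ T) (Function.update t j₁ s) * h' := by
            rw [hstep, ← mul_assoc, ← mul_hypA_comm_of_mem_fixer hp hq T t _
              (hypV_mem_fixer (p j₁) (q j₁) (inl_notMem_planeVecs hp hj₁) (inr_notMem_planeVecs hq hj₁) s),
              hypA_insert hp hq hj₁, Function.update_self,
              hypA_congr hp hq T (t := Function.update t j₁ s) (t' := t)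
                (fun j hj => Function.update_of_ne (fun h : j = j₁ => hj₁ (h ▸ hj)) _ _)]

variable [Fintype ι]

/-- **`KAK` decomposition of `U(α,β)` at arbitrary real rank**: if the planes `(p j, q j)` exhaust `α` or `β`
(`p` or `q` onto), every `g ∈ U(α,β)` is `k₁ · a_t · k₂` with `k₁, k₂ ∈ K = U(α) × U(β)`, `a_t = ∏_j a^{(p j,q j)}_{t_j}`
and `t ≥ 0` — the Cartan decomposition `G = K A⁺ K` of [Knapp2002, Thm. 7.39] for `U(p,q)`, by induction over the
planes (`kak_step`) and the terminal step `Fix(all planes) ≤ K`. [cite: Knapp2002, Thm 7.39] -/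
theorem exists_kV_mul_hypA_mul_kV_eq (hpq : Function.Surjective p ∨ Function.Surjective q) (g : UForm α β) :
    ∃ (k₁ k₂ : KV α β) (t : ι → ℝ), (∀ j, 0 ≤ t j) ∧
      g = UForm.kV α β k₁ * hypA hp hq Finset.univ t * UForm.kV α β k₂ := by
  obtain ⟨k₁, k₂, t, h, ht, hh, hg⟩ := exists_kak_fixer hp hq (Finset.univ : Finset ι) g
  have hK : ∃ k : KV α β, h = UForm.kV α β k := by
    rcases hpq with hp' | hq'
    · obtain ⟨w, hw⟩ := exists_eq_kV_inr_of_forall_inl h fun a => by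
        obtain ⟨j, rfl⟩ := hp' a
        exact hh _ (inl_mem_planeVecs.2 ⟨j, Finset.mem_univ _, rfl⟩)
      exact ⟨(1, w), hw⟩
    · obtain ⟨u, hu⟩ := exists_eq_kV_inl_of_forall_inr h fun b => by
        obtain ⟨j, rfl⟩ := hq' b
        exact hh _ (inr_mem_planeVecs.2 ⟨j, Finset.mem_univ _, rfl⟩)
      exact ⟨(u, 1), hu⟩
  obtain ⟨k, rfl⟩ := hK
  refine ⟨k₁⁻¹, k * k₂⁻¹, t, ht, ?_⟩
  rw [map_mul, map_inv, map_inv, ← mul_assoc, mul_assoc ((UForm.kV α β k₁)⁻¹), ← hg]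
  simp only [mul_assoc, mul_inv_cancel, mul_one, inv_mul_cancel_left]

/-- **`KAK` for `|β| ≤ |α|` with a chosen frame**: the planes `(e b, b)`, `b ∈ β`, for ANY injection `e : β ↪ α`.
[cite: Knapp2002, Thm 7.39] -/
theorem exists_kV_mul_hypA_mul_kV_eq_of_embedding_right (e : β ↪ α) (g : UForm α β) :
    ∃ (k₁ k₂ : KV α β) (t : β → ℝ), (∀ b, 0 ≤ t b) ∧
      g = UForm.kV α β k₁ * hypA (p := e) (q := id) e.injective Function.injective_id Finset.univ t *
        UForm.kV α β k₂ :=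
  exists_kV_mul_hypA_mul_kV_eq e.injective Function.injective_id (Or.inr Function.surjective_id) g

/-- **`KAK` for `|α| ≤ |β|` with a chosen frame**: the planes `(a, e a)`, `a ∈ α`, for ANY injection `e : α ↪ β`.
[cite: Knapp2002, Thm 7.39] -/
theorem exists_kV_mul_hypA_mul_kV_eq_of_embedding_left (e : α ↪ β) (g : UForm α β) :
    ∃ (k₁ k₂ : KV α β) (t : α → ℝ), (∀ a, 0 ≤ t a) ∧
      g = UForm.kV α β k₁ * hypA (p := id) (q := e) Function.injective_id e.injective Finset.univ t *
        UForm.kV α β k₂ :=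
  exists_kV_mul_hypA_mul_kV_eq Function.injective_id e.injective (Or.inl Function.surjective_id) g

/-- **`KAK`, frame-free form**: `U(α,β) = K · A · K` where `A` is the split torus of a frame of `min(|α|,|β|)` disjoint
planes matching an injection `β ↪ α` (if `|β| ≤ |α|`) — every `g` is `k₁ a_t k₂` with `t ≥ 0`.
[cite: Knapp2002, Thm 7.39] -/
theorem exists_kak_of_card_le (h : Fintype.card β ≤ Fintype.card α) (g : UForm α β) :
    ∃ (e : β ↪ α) (k₁ k₂ : KV α β) (t : β → ℝ), (∀ b, 0 ≤ t b) ∧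
      g = UForm.kV α β k₁ * hypA (p := e) (q := id) e.injective Function.injective_id Finset.univ t *
        UForm.kV α β k₂ := by
  obtain ⟨e⟩ := Function.Embedding.nonempty_of_card_le h
  exact ⟨e, exists_kV_mul_hypA_mul_kV_eq_of_embedding_right e g⟩

/-- **`KAK`, frame-free form** for `|α| ≤ |β|`. [cite: Knapp2002, Thm 7.39] -/
theorem exists_kak_of_card_ge (h : Fintype.card α ≤ Fintype.card β) (g : UForm α β) :
    ∃ (e : α ↪ β) (k₁ k₂ : KV α β) (t : α → ℝ), (∀ a, 0 ≤ t a) ∧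
      g = UForm.kV α β k₁ * hypA (p := id) (q := e) Function.injective_id e.injective Finset.univ t *
        UForm.kV α β k₂ := by
  obtain ⟨e⟩ := Function.Embedding.nonempty_of_card_le h
  exact ⟨e, exists_kV_mul_hypA_mul_kV_eq_of_embedding_left e g⟩

end KAK

/-! ## 3. The word map `K × ℝ^ι × K → U(α,β)` -/

section Word

variable {ι α β : Type*} [Fintype α] [DecidableEq α] [Fintype β] [DecidableEq β] [Fintype ι]
  {p : ι → α} {q : ι → β} (hp : Function.Injective p) (hq : Function.Injective q)

/-- **the `KAK` word map** `(k₁, t, k₂) ↦ k₁ · a_t · k₂ : K × ℝ^ι × K → U(α,β)`. [cite: Knapp2002, Thm 7.39] -/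
def kakMapA (x : KV α β × (ι → ℝ) × KV α β) : UForm α β :=
  UForm.kV α β x.1 * hypA hp hq Finset.univ x.2.1 * UForm.kV α β x.2.2

/-- unfolding `kakMapA`. [cite: Knapp2002, Thm 7.39] -/
theorem kakMapA_apply (k₁ : KV α β) (t : ι → ℝ) (k₂ : KV α β) :
    kakMapA hp hq (k₁, t, k₂) = UForm.kV α β k₁ * hypA hp hq Finset.univ t * UForm.kV α β k₂ := rfl

/-- **`kakMapA` is continuous.** [cite: Knapp2002, Thm 7.39] -/
theorem continuous_kakMapA : Continuous (kakMapA hp hq : KV α β × (ι → ℝ) × KV α β → UForm α β) :=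
  ((UForm.continuous_kV.comp continuous_fst).mul
    ((continuous_hypA hp hq Finset.univ).comp (continuous_fst.comp continuous_snd))).mul
    (UForm.continuous_kV.comp (continuous_snd.comp continuous_snd))

/-- **`kakMapA` is surjective** (`p` or `q` onto). [cite: Knapp2002, Thm 7.39] -/
theorem kakMapA_surjective (hpq : Function.Surjective p ∨ Function.Surjective q) :
    Function.Surjective (kakMapA hp hq : KV α β × (ι → ℝ) × KV α β → UForm α β) := fun g => by
  obtain ⟨k₁, k₂, t, -, hg⟩ := exists_kV_mul_hypA_mul_kV_eq hp hq hpq g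
  exact ⟨(k₁, t, k₂), hg.symm⟩

/-- surjectivity already from `t ≥ 0`: the image of `K × [0, ∞)^ι × K` is everything. [cite: Knapp2002, Thm 7.39] -/
theorem kakMapA_image_nonneg (hpq : Function.Surjective p ∨ Function.Surjective q) :
    (kakMapA hp hq : KV α β × (ι → ℝ) × KV α β → UForm α β) '' {x | ∀ j, 0 ≤ x.2.1 j} = Set.univ := by
  refine Set.eq_univ_of_forall fun g => ?_
  obtain ⟨k₁, k₂, t, ht, hg⟩ := exists_kV_mul_hypA_mul_kV_eq hp hq hpq g
  exact ⟨(k₁, t, k₂), ht, hg.symm⟩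

end Word

/-! ## 4. Properness: the Frobenius gauge -/

section Proper

variable {α β : Type*} [Fintype α] [DecidableEq α] [Fintype β] [DecidableEq β]

/-- **the Frobenius gauge** `g ↦ Σ_{i,i'} |g_{i i'}|²` on `U(α,β)`. [cite: HornJohnson2013, 0.2.5] -/
def frob (g : UForm α β) : ℝ :=
  ∑ i, ∑ i', ‖(((g : UForm α β) : GL (α ⊕ β) ℂ) : Matrix (α ⊕ β) (α ⊕ β) ℂ) i i'‖ ^ 2

/-- the gauge is continuous. [cite: HornJohnson2013, 0.2.5] -/
theorem continuous_frob : Continuous (frob : UForm α β → ℝ) :=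
  continuous_finsetSum _ fun i _ => continuous_finsetSum _ fun i' _ =>
    (((Units.continuous_val.comp continuous_subtype_val).matrix_elem i i').norm).pow 2

/-- **the gauge is a trace**: `Σ_{i,i'} |g_{i i'}|² = tr(gᴴ g)`. [cite: HornJohnson2013, 0.2.5] -/
theorem frob_eq_trace (g : UForm α β) :
    ((frob g : ℝ) : ℂ) = Matrix.trace ((((g : UForm α β) : GL (α ⊕ β) ℂ) : Matrix (α ⊕ β) (α ⊕ β) ℂ)ᴴ *
      (((g : UForm α β) : GL (α ⊕ β) ℂ) : Matrix (α ⊕ β) (α ⊕ β) ℂ)) := by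
  rw [frob, Matrix.trace, Finset.sum_comm]
  push_cast
  refine Finset.sum_congr rfl fun i' _ => ?_
  rw [Matrix.diag_apply, Matrix.mul_apply]
  exact Finset.sum_congr rfl fun i _ => by rw [Matrix.conjTranspose_apply, ← Complex.conj_mul', Complex.star_def]

/-- the matrix of `kV k` is unitary: `(kV k)ᴴ (kV k) = 1`. [cite: HornJohnson2013, Thm 2.1.4] -/
theorem conjTranspose_kV_mul_self (k : KV α β) :
    ((((UForm.kV α β k : UForm α β) : GL (α ⊕ β) ℂ) : Matrix (α ⊕ β) (α ⊕ β) ℂ))ᴴ *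
      (((UForm.kV α β k : UForm α β) : GL (α ⊕ β) ℂ) : Matrix (α ⊕ β) (α ⊕ β) ℂ) = 1 := by
  rw [UForm.coe_kV, Matrix.fromBlocks_conjTranspose, Matrix.fromBlocks_multiply]
  simp only [Matrix.conjTranspose_zero, Matrix.mul_zero, Matrix.zero_mul, add_zero, zero_add]
  rw [← Matrix.star_eq_conjTranspose, ← Matrix.star_eq_conjTranspose, Matrix.UnitaryGroup.star_mul_self,
    Matrix.UnitaryGroup.star_mul_self, Matrix.fromBlocks_one]

/-- the matrix of `kV k` is unitary: `(kV k) (kV k)ᴴ = 1`. [cite: HornJohnson2013, Thm 2.1.4] -/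
theorem kV_mul_conjTranspose_self (k : KV α β) :
    (((UForm.kV α β k : UForm α β) : GL (α ⊕ β) ℂ) : Matrix (α ⊕ β) (α ⊕ β) ℂ) *
      ((((UForm.kV α β k : UForm α β) : GL (α ⊕ β) ℂ) : Matrix (α ⊕ β) (α ⊕ β) ℂ))ᴴ = 1 :=
  mul_eq_one_comm.1 (conjTranspose_kV_mul_self k)

/-- **left `K`-invariance of the gauge.** [cite: HornJohnson2013, Thm 2.1.4] -/
theorem frob_kV_mul (k : KV α β) (g : UForm α β) : frob (UForm.kV α β k * g) = frob g := by
  apply Complex.ofReal_injective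
  rw [frob_eq_trace, frob_eq_trace, UForm.coe_mul, Matrix.conjTranspose_mul, Matrix.mul_assoc,
    ← Matrix.mul_assoc _ _ ((((g : UForm α β) : GL (α ⊕ β) ℂ) : Matrix (α ⊕ β) (α ⊕ β) ℂ)),
    conjTranspose_kV_mul_self, Matrix.one_mul]

/-- **right `K`-invariance of the gauge.** [cite: HornJohnson2013, Thm 2.1.4] -/
theorem frob_mul_kV (g : UForm α β) (k : KV α β) : frob (g * UForm.kV α β k) = frob g := by
  apply Complex.ofReal_injective
  rw [frob_eq_trace, frob_eq_trace, UForm.coe_mul, Matrix.conjTranspose_mul, Matrix.mul_assoc, Matrix.trace_mul_comm,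
    Matrix.mul_assoc, Matrix.mul_assoc, kV_mul_conjTranspose_self, Matrix.mul_one]

/-- a diagonal entry is dominated by the gauge: `|g_{i i}|² ≤ frob g`, and so is any partial diagonal sum.
[cite: HornJohnson2013, 0.2.5] -/
theorem sum_diag_le_frob (g : UForm α β) (s : Finset (α ⊕ β)) :
    ∑ i ∈ s, ‖(((g : UForm α β) : GL (α ⊕ β) ℂ) : Matrix (α ⊕ β) (α ⊕ β) ℂ) i i‖ ^ 2 ≤ frob g := by
  calc ∑ i ∈ s, ‖(((g : UForm α β) : GL (α ⊕ β) ℂ) : Matrix (α ⊕ β) (α ⊕ β) ℂ) i i‖ ^ 2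
      ≤ ∑ i, ‖(((g : UForm α β) : GL (α ⊕ β) ℂ) : Matrix (α ⊕ β) (α ⊕ β) ℂ) i i‖ ^ 2 :=
        Finset.sum_le_sum_of_subset_of_nonneg (Finset.subset_univ s) fun i _ _ => sq_nonneg _
    _ ≤ frob g := Finset.sum_le_sum fun i _ =>
        Finset.single_le_sum (f := fun i' => ‖(((g : UForm α β) : GL (α ⊕ β) ℂ) : Matrix (α ⊕ β) (α ⊕ β) ℂ) i i'‖ ^ 2)
          (fun i' _ => sq_nonneg _) (Finset.mem_univ i)

variable {ι : Type*} [Fintype ι] {p : ι → α} {q : ι → β} (hp : Function.Injective p)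
  (hq : Function.Injective q)

/-- **`Σ_j t_j² ≤ frob a_t`**: the diagonal entries `cosh t_j` of `a_t` at the `q j` dominate `|t_j|`.
[cite: Knapp2002, Thm 7.39] -/
theorem sum_sq_le_frob_hypA (t : ι → ℝ) : ∑ j, t j ^ 2 ≤ frob (hypA hp hq Finset.univ t : UForm α β) := by
  have hinj : Function.Injective (fun j : ι => (Sum.inr (q j) : α ⊕ β)) := fun j j' h => hq (Sum.inr_injective h)
  calc ∑ j, t j ^ 2 ≤ ∑ j, ‖(((hypA hp hq Finset.univ t : UForm α β) : GL (α ⊕ β) ℂ) : Matrix (α ⊕ β) (α ⊕ β) ℂ)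
        (Sum.inr (q j)) (Sum.inr (q j))‖ ^ 2 := Finset.sum_le_sum fun j _ => by
          rw [hypA_apply_inr_inr_self hp hq Finset.univ t (Finset.mem_univ j), Complex.norm_real, Real.norm_eq_abs,
            abs_of_pos (Real.cosh_pos _), ← sq_abs (t j)]
          exact pow_le_pow_left₀ (abs_nonneg _) (abs_le_cosh (t j)) 2
    _ = ∑ i ∈ Finset.univ.image (fun j : ι => (Sum.inr (q j) : α ⊕ β)),
          ‖(((hypA hp hq Finset.univ t : UForm α β) : GL (α ⊕ β) ℂ) : Matrix (α ⊕ β) (α ⊕ β) ℂ) i i‖ ^ 2 :=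
        (Finset.sum_image (f := fun i : α ⊕ β =>
          ‖(((hypA hp hq Finset.univ t : UForm α β) : GL (α ⊕ β) ℂ) : Matrix (α ⊕ β) (α ⊕ β) ℂ) i i‖ ^ 2)
          fun j _ j' _ h => hinj h).symm
    _ ≤ frob (hypA hp hq Finset.univ t : UForm α β) := sum_diag_le_frob _ _

/-- the gauge of a `KAK` word depends on `t` alone. [cite: Knapp2002, Thm 7.39] -/
theorem frob_kakMapA (x : KV α β × (ι → ℝ) × KV α β) :
    frob (kakMapA hp hq x) = frob (hypA hp hq Finset.univ x.2.1 : UForm α β) := by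
  obtain ⟨k₁, t, k₂⟩ := x
  rw [kakMapA_apply, frob_mul_kV, frob_kV_mul]

/-- `t ↦ frob a_t` is a proper map `ℝ^ι → ℝ` (continuous and `≥ Σ_j t_j²`). [cite: Knapp2002, Thm 7.39] -/
theorem isProperMap_frob_hypA : IsProperMap fun t : ι → ℝ => frob (hypA hp hq Finset.univ t : UForm α β) := by
  have hc : Continuous fun t : ι → ℝ => frob (hypA hp hq Finset.univ t : UForm α β) :=
    continuous_frob.comp (continuous_hypA hp hq Finset.univ)
  rw [isProperMap_iff_isCompact_preimage]
  refine ⟨hc, fun K hK => ?_⟩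
  obtain ⟨R, hR⟩ := hK.isBounded.subset_closedBall 0
  refine Metric.isCompact_of_isClosed_isBounded (hK.isClosed.preimage hc)
    ((Metric.isBounded_closedBall (x := (0 : ι → ℝ)) (r := Real.sqrt R)).subset fun t ht => ?_)
  have h1 : frob (hypA hp hq Finset.univ t : UForm α β) ≤ R := by
    have h := hR ht
    rw [Metric.mem_closedBall, dist_zero_right, Real.norm_eq_abs] at h
    exact (le_abs_self _).trans h
  rw [Metric.mem_closedBall, dist_zero_right, pi_norm_le_iff_of_nonneg (Real.sqrt_nonneg R)]
  intro j
  rw [Real.norm_eq_abs, ← Real.sqrt_sq_eq_abs]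
  refine Real.sqrt_le_sqrt (le_trans ?_ ((sum_sq_le_frob_hypA hp hq t).trans h1))
  exact Finset.single_le_sum (f := fun j => t j ^ 2) (fun j _ => sq_nonneg _) (Finset.mem_univ j)

/-- **`kakMapA` is a proper map**: its composite with the continuous gauge is the proper function `t ↦ frob a_t` of
`t` alone, `K` being compact; a continuous map whose composite with a continuous map to a Hausdorff space is proper
is itself proper. [cite: Knapp2002, Thm 7.39] -/
theorem isProperMap_kakMapA : IsProperMap (kakMapA hp hq : KV α β × (ι → ℝ) × KV α β → UForm α β) := by
  haveI : CompactSpace (Matrix.unitaryGroup α ℂ) := isCompact_iff_compactSpace.mp Matrix.isCompact_unitaryGroup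
  haveI : CompactSpace (Matrix.unitaryGroup β ℂ) := isCompact_iff_compactSpace.mp Matrix.isCompact_unitaryGroup
  refine isProperMap_of_comp_of_t2 (continuous_kakMapA hp hq) continuous_frob ?_
  have h : frob ∘ (kakMapA hp hq : KV α β × (ι → ℝ) × KV α β → UForm α β) =
      (fun t : ι → ℝ => frob (hypA hp hq Finset.univ t : UForm α β)) ∘ (Prod.fst ∘ Prod.snd) :=
    funext (frob_kakMapA hp hq)
  rw [h]
  exact (isProperMap_frob_hypA hp hq).comp (isProperMap_fst_of_compactSpace.comp isProperMap_snd_of_compactSpace)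

/-- **`kakMapA` is a closed map.** [cite: Knapp2002, Thm 7.39] -/
theorem isClosedMap_kakMapA : IsClosedMap (kakMapA hp hq : KV α β × (ι → ℝ) × KV α β → UForm α β) :=
  (isProperMap_kakMapA hp hq).isClosedMap

/-- the preimage of a compact set under `kakMapA` is compact. [cite: Knapp2002, Thm 7.39] -/
theorem isCompact_preimage_kakMapA {C : Set (UForm α β)} (hC : IsCompact C) :
    IsCompact ((kakMapA hp hq : KV α β × (ι → ℝ) × KV α β → UForm α β) ⁻¹' C) :=
  (isProperMap_kakMapA hp hq).isCompact_preimage hC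

end Proper

/-! ## 5. Quotient-map corollaries: continuity on `U(α,β)` is continuity in `(k₁, t, k₂)`, at every rank -/

section Quotient

variable {ι α β : Type*} [Fintype α] [DecidableEq α] [Fintype β] [DecidableEq β] [Fintype ι]
  {p : ι → α} {q : ι → β} (hp : Function.Injective p) (hq : Function.Injective q)
  (hpq : Function.Surjective p ∨ Function.Surjective q)
include hpq

/-- **`kakMapA` is a quotient map**: closed, continuous, surjective. [cite: Knapp2002, Thm 7.39] -/
theorem isQuotientMap_kakMapA :
    Topology.IsQuotientMap (kakMapA hp hq : KV α β × (ι → ℝ) × KV α β → UForm α β) :=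
  (isClosedMap_kakMapA hp hq).isQuotientMap (continuous_kakMapA hp hq) (kakMapA_surjective hp hq hpq)

omit hpq in
/-- `kakMapA × id_X` is a proper map for every space `X`. [cite: Knapp2002, Thm 7.39] -/
theorem isProperMap_kakMapA_prodMap (X : Type*) [TopologicalSpace X] :
    IsProperMap (Prod.map (kakMapA hp hq : KV α β × (ι → ℝ) × KV α β → UForm α β) (id : X → X)) :=
  (isProperMap_kakMapA hp hq).prodMap isProperMap_id

/-- **`kakMapA × id_X` is a quotient map** for every space `X` — the form used to descend JOINT continuity in
`(g, x)`. [cite: Knapp2002, Thm 7.39] -/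
theorem isQuotientMap_kakMapA_prodMap (X : Type*) [TopologicalSpace X] :
    Topology.IsQuotientMap
      (Prod.map (kakMapA hp hq : KV α β × (ι → ℝ) × KV α β → UForm α β) (id : X → X)) :=
  (isProperMap_kakMapA_prodMap hp hq X).isClosedMap.isQuotientMap
    ((continuous_kakMapA hp hq).prodMap continuous_id)
    ((kakMapA_surjective hp hq hpq).prodMap Function.surjective_id)

/-- **descent of continuity**: `f : U(α,β) → Z` is continuous iff `(k₁, t, k₂) ↦ f (k₁ a_t k₂)` is.
[cite: Knapp2002, Thm 7.39] -/
theorem continuous_iff_comp_kakMapA {Z : Type*} [TopologicalSpace Z] {f : UForm α β → Z} :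
    Continuous f ↔ Continuous (f ∘ (kakMapA hp hq : KV α β × (ι → ℝ) × KV α β → UForm α β)) :=
  (isQuotientMap_kakMapA hp hq hpq).continuous_iff

/-- **descent of joint continuity**: `f : U(α,β) × X → Z` is continuous iff `((k₁, t, k₂), x) ↦ f (k₁ a_t k₂, x)` is.
[cite: Knapp2002, Thm 7.39] -/
theorem continuous_iff_comp_kakMapA_prodMap {X Z : Type*} [TopologicalSpace X] [TopologicalSpace Z]
    {f : UForm α β × X → Z} :
    Continuous f ↔ Continuous
      (f ∘ Prod.map (kakMapA hp hq : KV α β × (ι → ℝ) × KV α β → UForm α β) (id : X → X)) :=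
  (isQuotientMap_kakMapA_prodMap hp hq hpq X).continuous_iff

end Quotient

/-! ## 6. `K`-trivial characters are trivial, at every rank -/

section Character

variable {ι α β : Type*} [Fintype α] [DecidableEq α] [Fintype β] [DecidableEq β]
  {p : ι → α} {q : ι → β} (hp : Function.Injective p) (hq : Function.Injective q)
variable {A : Type*} [CommGroup A]

/-- a `K`-trivial homomorphism kills every planar boost: `χ(a_t) = χ(w a_t w⁻¹) = χ(a_{−t}) = χ(a_t)⁻¹` for the Weyl
element `w ∈ K` of the plane, and `χ(a_t) = χ(a_{t/2})²`. [cite: Knapp2002, Thm 7.39] -/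
theorem hom_hypV_eq_one (p₀ : α) (q₀ : β) (χ : UForm α β →* A) (hχ : ∀ k, χ (UForm.kV α β k) = 1) (t : ℝ) :
    χ (hypV p₀ q₀ t) = 1 := by
  have hsq : ∀ t : ℝ, χ (hypV p₀ q₀ t) ^ 2 = 1 := fun t => by
    have hw := congrArg χ (kV_weylKV_mul_hypV_mul_inv p₀ q₀ t)
    rw [map_mul, map_mul, map_inv, hχ, one_mul, inv_one, mul_one, hypV_neg, map_inv] at hw
    rw [sq]
    nth_rewrite 2 [hw]
    rw [mul_inv_cancel]
  have h2 : hypV p₀ q₀ t = (hypV p₀ q₀ (t / 2) : UForm α β) * hypV p₀ q₀ (t / 2) := by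
    rw [← hypV_add, add_halves]
  rw [h2, map_mul, ← sq, hsq]

/-- a `K`-trivial homomorphism kills `a^{(T)}_t`. [cite: Knapp2002, Thm 7.39] -/
theorem hom_hypA_eq_one (χ : UForm α β →* A) (hχ : ∀ k, χ (UForm.kV α β k) = 1) (T : Finset ι) (t : ι → ℝ) :
    χ (hypA hp hq T t) = 1 := by
  classical
  induction T using Finset.induction_on with
  | empty => rw [hypA_empty, map_one]
  | insert j T hj ih => rw [hypA_insert hp hq hj, map_mul, hom_hypV_eq_one _ _ χ hχ, ih, one_mul]

omit hp hq in
/-- **a homomorphism from `U(α,β)` to a commutative group that is trivial on `K = U(α) × U(β)` is trivial** — at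
every real rank, with no continuity assumption: `G = K A K` for the frame of `min(|α|,|β|)` planes matching an
injection `β ↪ α` (or `α ↪ β`), and `χ` kills `K` and every planar boost. [cite: Knapp2002, Thm 7.39] -/
theorem UForm.hom_eq_one_of_forall_kV (χ : UForm α β →* A) (hχ : ∀ k, χ (UForm.kV α β k) = 1) : χ = 1 := by
  classical
  ext g
  rw [MonoidHom.one_apply]
  rcases le_total (Fintype.card β) (Fintype.card α) with hle | hle
  · obtain ⟨e⟩ := Function.Embedding.nonempty_of_card_le hle
    obtain ⟨k₁, k₂, t, -, rfl⟩ := exists_kV_mul_hypA_mul_kV_eq (p := e) (q := id) e.injective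
      Function.injective_id (Or.inr Function.surjective_id) g
    rw [map_mul, map_mul, hχ, hχ, hom_hypA_eq_one e.injective Function.injective_id χ hχ, one_mul, one_mul]
  · obtain ⟨e⟩ := Function.Embedding.nonempty_of_card_le hle
    obtain ⟨k₁, k₂, t, -, rfl⟩ := exists_kV_mul_hypA_mul_kV_eq (p := id) (q := e) Function.injective_id
      e.injective (Or.inl Function.surjective_id) g
    rw [map_mul, map_mul, hχ, hχ, hom_hypA_eq_one Function.injective_id e.injective χ hχ, one_mul, one_mul]

omit hp hq in
/-- **two homomorphisms from `U(α,β)` to a commutative group that agree on `K` agree**, at every real rank.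
[cite: Knapp2002, Thm 7.39] -/
theorem UForm.hom_eq_of_forall_kV (χ χ' : UForm α β →* A) (h : ∀ k, χ (UForm.kV α β k) = χ' (UForm.kV α β k)) :
    χ = χ' := by
  rw [← div_eq_one]
  exact UForm.hom_eq_one_of_forall_kV _ fun k => by rw [MonoidHom.div_apply, h, div_self']

end Character

end RealDualPair

end Literature.RepresentationTheory.KonnoKonno2007

end
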